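import Summits.ABC.StewartYu.PadicG3ParVL
import HarnessLib

/-!
# The `p`-adic Gen-3 parameter record v2 (corrected family `…V`) — part VM: THE m = 0 HEADLINE

Support file (plain theorems; no named facts). Continues `PadicG3ParVL`. Assembly of the headline of the m = 0
record (plan g9 2026-08-27T04:41:32Z `headline_V`; spec HOME/p1/HEADLINE-V-spec.md §3): under the m = 0 context
(`m = 0`, `θ₀ = ½`, `n ≥ 2`, `A j ≥ 1`, `Amax ≤ 2ⁿΩ`, `N_q = K`, `K₀ = p − 1`)
**`8·2ⁿ·Zp + CondFloorV n ≤ 2^{44}·(16·C_b)ⁿ·(p/log p)·Ω·W⁺`**, `W⁺ = W + log p + log(2Amax)`, i.e. the order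
hypothesis `hU` of `order_budgetV` (VE) is met by any `U ≥ 2^{44}(16 C_b)ⁿ (p/log p) Ω W⁺`, in particular by the
negated crux bound with `cY07 ≥ 2^{22}·16·C_b` per factor (n ≥ 2). Pieces: `8·2ⁿZp = 2^{n+6}(n+1)·XV·(g²LgV)` (VH),
`g²LgV ≤ 2^{27}C_bⁿΩp` (VK), `XV ≤ 424(n+1)(n+2)W⁺/log p` (VL), `CondFloorV n ≤ 2^{2n+27}N_q g² XV (log p/(p−1))` (VG)
with `N_q = p − 1`, `g = log p/(16(n+1))`, `(log p)³ ≤ 64 p`, `(n+1)²(n+2) ≤ 2^{3n+1}`, `4ⁿ ≤ (8 C_b)ⁿ`-type absorptions.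

## References
* [Yu2013] K. Yu, Acta Math. 211 (2013) — Theorem 1 (shape of the main term).
-/

noncomputable section

open Finset Real

namespace Summit.ABC.StewartYu

namespace PadicG3Par

variable {n : ℕ} (P : PadicG3Par n)

/-- `(n+1)²(n+2) ≤ 2·8ⁿ`. [folklore] -/
theorem poly_le_pow (n : ℕ) : ((n : ℝ) + 1) ^ 2 * (n + 2) ≤ 2 * 8 ^ n := by
  have h1 : ((n : ℝ) + 1) ≤ 2 ^ n := by exact_mod_cast Nat.succ_le_of_lt n.lt_two_pow_self
  have h2 : ((n : ℝ) + 2) ≤ 2 * 2 ^ n := by linarith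
  have h0 : (0 : ℝ) ≤ (n : ℝ) + 1 := by positivity
  have e : (2 : ℝ) * 8 ^ n = (2 ^ n) ^ 2 * (2 * 2 ^ n) := by
    rw [show (8 : ℝ) = 2 ^ 3 by norm_num, ← pow_mul]; ring
  rw [e]
  exact mul_le_mul (pow_le_pow_left₀ h0 h1 2) h2 (by positivity) (by positivity)

/-- at the m = 0 context: **`8·2ⁿ·Zp ≤ 424·2^{n+34}·(8·C_b)ⁿ·(p/log p)·Ω·W⁺`**. [cite: Yu2013, Theorem 1 (shape)] -/
theorem main_term_le (hm : P.m = 0) (hθ : P.θ₀ = 1 / 2) (hn2 : 2 ≤ n) (hA1 : ∀ j, 1 ≤ P.A j)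
    (hAmaxΩ : P.Amax ≤ 2 ^ n * P.Ω) (hNq : P.Nq = P.K) (hK₀ : (P.K₀ : ℝ) = P.p - 1) :
    8 * 2 ^ n * P.Zp ≤ 424 * 2 ^ (n + 34) * (8 * Cb) ^ n * (P.p / Real.log P.p) * P.Ω * P.Wplus := by
  rw [P.eight_two_pow_Zp_eq]
  have hL := P.g_sq_LgV_le_main hm hθ hn2 hA1 hAmaxΩ hNq
  have hX := P.XV_le_main hm hθ hn2 hA1 hAmaxΩ hNq hK₀
  have hl := P.log_p_pos
  obtain ⟨hlW, _, _, _⟩ := P.Wplus_facts hA1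
  have hWp0 : 0 ≤ P.Wplus := by linarith
  have hΩ := P.one_le_Ω hA1
  have hp : (2 : ℝ) ≤ P.p := P.two_le_p
  have hCb0 := Cb_pos
  have hpoly := poly_le_pow n
  have hX0 : (0 : ℝ) ≤ P.XV := by positivity
  have hgL0 : 0 ≤ P.g ^ 2 * P.LgV := by have := P.one_le_g; positivity
  -- `2^{n+6}(n+1) · XV · (g² LgV) ≤ 2^{n+6}(n+1) · [424(n+1)(n+2)W⁺/log p] · [2^27 C_bⁿ Ω p]`
  have h1 : (2 : ℝ) ^ (n + 6) * (n + 1) * P.g ^ 2 * P.XV * P.LgV =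
      2 ^ (n + 6) * (n + 1) * (P.XV * (P.g ^ 2 * P.LgV)) := by ring
  rw [h1]
  have h2 : (P.XV : ℝ) * (P.g ^ 2 * P.LgV) ≤ (424 * (n + 1) * (n + 2) * P.Wplus / Real.log P.p) * (2 ^ 27 * Cb ^ n * P.Ω * P.p) :=
    mul_le_mul hX hL hgL0 (by positivity)
  have h3 := mul_le_mul_of_nonneg_left h2 (by positivity : (0:ℝ) ≤ 2 ^ (n + 6) * (n + 1))
  refine h3.trans ?_
  -- compare coefficients: `2^{n+6}(n+1)·424(n+1)(n+2)·2^27 C_bⁿ ≤ 424·2^{n+34}·8ⁿ·C_bⁿ`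
  have hposW : 0 ≤ P.Wplus / Real.log P.p * (P.Ω * P.p) := by positivity
  have e1 : 2 ^ (n + 6) * ((n : ℝ) + 1) * ((424 * (n + 1) * (n + 2) * P.Wplus / Real.log P.p) * (2 ^ 27 * Cb ^ n * P.Ω * P.p)) =
      (424 * 2 ^ (n + 33) * Cb ^ n * (((n : ℝ) + 1) ^ 2 * (n + 2))) * (P.Wplus / Real.log P.p * (P.Ω * P.p)) := by
    rw [pow_add, pow_add]; ring
  have e2 : 424 * 2 ^ (n + 34) * (8 * Cb) ^ n * ((P.p : ℝ) / Real.log P.p) * P.Ω * P.Wplus =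
      (424 * 2 ^ (n + 33) * Cb ^ n * (2 * 8 ^ n)) * (P.Wplus / Real.log P.p * (P.Ω * P.p)) := by
    rw [mul_pow, pow_add, pow_add, div_eq_mul_inv, div_eq_mul_inv]; ring
  rw [e1, e2]
  refine mul_le_mul_of_nonneg_right ?_ hposW
  exact mul_le_mul_of_nonneg_left hpoly (by positivity)

/-- at the m = 0 context: **`CondFloorV n ≤ 424·2^{2n+26}·(p/log p)·Ω·W⁺`** (`N_q = p − 1`, `(log p)³ ≤ 64p`). [folklore] -/
theorem CondFloorV_le_main (hm : P.m = 0) (hθ : P.θ₀ = 1 / 2) (hn2 : 2 ≤ n) (hA1 : ∀ j, 1 ≤ P.A j)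
    (hAmaxΩ : P.Amax ≤ 2 ^ n * P.Ω) (hNq : P.Nq = P.K) (hK₀ : (P.K₀ : ℝ) = P.p - 1) :
    P.CondFloorV n ≤ 424 * 2 ^ (2 * n + 26) * (P.p / Real.log P.p) * P.Ω * P.Wplus := by
  have h0 := P.CondFloorV_le n
  have hX := P.XV_le_main hm hθ hn2 hA1 hAmaxΩ hNq hK₀
  have hl := P.log_p_pos
  have hl16 := P.sixteen_mul_le_log_p hm hθ
  obtain ⟨hlW, _, _, _⟩ := P.Wplus_facts hA1
  have hWp0 : 0 ≤ P.Wplus := by linarith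
  have hΩ := P.one_le_Ω hA1
  have hp : (2 : ℝ) ≤ P.p := P.two_le_p
  -- `N_q · (log p/(p−1)) = log p` (as `N_q = K = p − 1`)
  have hK : (P.K : ℝ) = P.p - 1 := by
    have : (P.K : ℝ) = (P.p : ℝ) ^ P.m * P.K₀ := by unfold K; push_cast; ring
    rw [this, hm, pow_zero, one_mul, hK₀]
  have hNqR : (P.Nq : ℝ) = P.p - 1 := by rw [← hK]; exact_mod_cast hNq
  have hp1 : (P.p : ℝ) - 1 ≠ 0 := by linarith
  have hNql : (P.Nq : ℝ) * (Real.log P.p / (P.p - 1)) = Real.log P.p := by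
    rw [hNqR, ← mul_div_assoc, mul_div_cancel_left₀ _ hp1]
  -- `g = log p/(16(n+1))`
  have hg : P.g = Real.log P.p / (16 * (n + 1)) := by
    unfold g cG; rw [P.G_eq_half_log hm hθ]; field_simp; ring
  -- `(log p)^3 ≤ 64 p`
  have hq := P.log_p_le_four_exp
  have hq4 := P.exp_log_div_four_pow
  have hq1 : 1 ≤ Real.exp (Real.log P.p / 4) := Real.one_le_exp (by positivity)
  have hl3 : Real.log P.p ^ 3 ≤ 64 * P.p := by
    have h1 : Real.log P.p ^ 3 ≤ (4 * Real.exp (Real.log P.p / 4)) ^ 3 := pow_le_pow_left₀ hl.le hq 3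
    have h2 : Real.exp (Real.log P.p / 4) ^ 3 ≤ Real.exp (Real.log P.p / 4) ^ 4 := pow_le_pow_right₀ hq1 (by norm_num)
    nlinarith
  -- rewrite the VG bound
  have e0 : (2 : ℝ) ^ (n + n + 27) * P.Nq * P.g ^ 2 * P.XV * (Real.log P.p / (P.p - 1)) =
      2 ^ (n + n + 27) * P.g ^ 2 * P.XV * (P.Nq * (Real.log P.p / (P.p - 1))) := by ring
  rw [e0, hNql, hg] at h0
  -- `h0 : CondFloorV n ≤ 2^{2n+27} (log p/(16(n+1)))² XV log p`
  have hn1 : (0 : ℝ) < (n : ℝ) + 1 := by positivity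
  have hX0 : (0 : ℝ) ≤ P.XV := by positivity
  have step : (2 : ℝ) ^ (n + n + 27) * (Real.log P.p / (16 * (n + 1))) ^ 2 * P.XV * Real.log P.p ≤
      2 ^ (n + n + 27) * (Real.log P.p / (16 * (n + 1))) ^ 2 * (424 * (n + 1) * (n + 2) * P.Wplus / Real.log P.p) * Real.log P.p := by
    have h00 : (0 : ℝ) ≤ 2 ^ (n + n + 27) * (Real.log P.p / (16 * (n + 1))) ^ 2 := by positivity
    exact mul_le_mul_of_nonneg_right (mul_le_mul_of_nonneg_left hX h00) hl.le
  have e1 : (2 : ℝ) ^ (n + n + 27) * (Real.log P.p / (16 * (n + 1))) ^ 2 * (424 * (n + 1) * (n + 2) * P.Wplus / Real.log P.p) * Real.log P.p =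
      424 * 2 ^ (n + n + 19) * ((n + 2) / (n + 1)) * Real.log P.p ^ 2 * P.Wplus := by
    have e : (2 : ℝ) ^ (n + n + 27) = 2 ^ (n + n + 19) * 2 ^ 8 := by rw [← pow_add]
    rw [e]; field_simp; ring
  have hratio : ((n : ℝ) + 2) / (n + 1) ≤ 2 := by rw [div_le_iff₀ hn1]; linarith
  have hmid : P.CondFloorV n ≤ 424 * 2 ^ (n + n + 20) * Real.log P.p ^ 2 * P.Wplus := by
    have h00 : (0 : ℝ) ≤ 424 * 2 ^ (n + n + 19) := by positivity
    have h01 : (0 : ℝ) ≤ Real.log P.p ^ 2 * P.Wplus := by positivity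
    have := mul_le_mul_of_nonneg_left hratio h00
    have e2 : (424 : ℝ) * 2 ^ (n + n + 20) = 424 * 2 ^ (n + n + 19) * 2 := by rw [pow_succ]; ring
    calc P.CondFloorV n ≤ 424 * 2 ^ (n + n + 19) * ((n + 2) / (n + 1)) * Real.log P.p ^ 2 * P.Wplus := by
          rw [← e1]; exact h0.trans step
      _ = (424 * 2 ^ (n + n + 19) * ((n + 2) / (n + 1))) * (Real.log P.p ^ 2 * P.Wplus) := by ring
      _ ≤ (424 * 2 ^ (n + n + 19) * 2) * (Real.log P.p ^ 2 * P.Wplus) := mul_le_mul_of_nonneg_right this h01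
      _ = 424 * 2 ^ (n + n + 20) * Real.log P.p ^ 2 * P.Wplus := by rw [e2]; ring
  -- `(log p)² ≤ 64 p/log p ≤ 64 (p/log p) Ω`
  have hl2 : Real.log P.p ^ 2 ≤ 64 * (P.p / Real.log P.p) * P.Ω := by
    have h1 : Real.log P.p ^ 2 = Real.log P.p ^ 3 / Real.log P.p := by field_simp
    have h2 : Real.log P.p ^ 3 / Real.log P.p ≤ 64 * P.p / Real.log P.p := div_le_div_of_nonneg_right hl3 hl.le
    have h3 : 64 * (P.p : ℝ) / Real.log P.p ≤ 64 * (P.p / Real.log P.p) * P.Ω := by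
      have h00 : (0 : ℝ) ≤ 64 * (P.p / Real.log P.p) := by positivity
      have := mul_le_mul_of_nonneg_left hΩ h00
      have e : 64 * (P.p : ℝ) / Real.log P.p = 64 * (P.p / Real.log P.p) * 1 := by ring
      linarith
    linarith
  have e3 : (2 : ℝ) ^ (2 * n + 26) = 2 ^ (n + n + 20) * 64 := by
    rw [show 2 * n + 26 = (n + n + 20) + 6 by omega, pow_add]; norm_num
  rw [e3]
  have h00 : (0 : ℝ) ≤ 424 * 2 ^ (n + n + 20) * P.Wplus := by positivity
  have := mul_le_mul_of_nonneg_left hl2 h00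
  have e4 : 424 * 2 ^ (n + n + 20) * Real.log P.p ^ 2 * P.Wplus = 424 * 2 ^ (n + n + 20) * P.Wplus * Real.log P.p ^ 2 := by ring
  have e5 : 424 * (2 ^ (n + n + 20) * 64) * ((P.p : ℝ) / Real.log P.p) * P.Ω * P.Wplus =
      424 * 2 ^ (n + n + 20) * P.Wplus * (64 * (P.p / Real.log P.p) * P.Ω) := by ring
  linarith

/-- **THE m = 0 HEADLINE `headline_V`: `8·2ⁿ·Zp + CondFloorV n ≤ 2^{44}·(16·C_b)ⁿ·(p/log p)·Ω·W⁺`** under the m = 0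
context — the `hU` of `order_budgetV` for every `U ≥ 2^{44}(16C_b)ⁿ(p/log p)ΩW⁺`. [cite: Yu2013, Theorem 1 (shape)] -/
theorem headline_V (hm : P.m = 0) (hθ : P.θ₀ = 1 / 2) (hn2 : 2 ≤ n) (hA1 : ∀ j, 1 ≤ P.A j)
    (hAmaxΩ : P.Amax ≤ 2 ^ n * P.Ω) (hNq : P.Nq = P.K) (hK₀ : (P.K₀ : ℝ) = P.p - 1) :
    8 * 2 ^ n * P.Zp + P.CondFloorV n ≤ 2 ^ 44 * (16 * Cb) ^ n * (P.p / Real.log P.p) * P.Ω * P.Wplus := by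
  have h1 := P.main_term_le hm hθ hn2 hA1 hAmaxΩ hNq hK₀
  have h2 := P.CondFloorV_le_main hm hθ hn2 hA1 hAmaxΩ hNq hK₀
  have hl := P.log_p_pos
  obtain ⟨hlW, _, _, _⟩ := P.Wplus_facts hA1
  have hWp0 : 0 ≤ P.Wplus := by linarith
  have hΩ := P.one_le_Ω hA1
  have hCb := two_le_Cb
  have hB0 : 0 ≤ (P.p : ℝ) / Real.log P.p * P.Ω * P.Wplus := by positivity
  -- coefficients: `424·2^{n+34}·(8C_b)ⁿ + 424·2^{2n+26} ≤ 2^{44}·(16 C_b)ⁿ`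
  have h16 : ((16 : ℝ) * Cb) ^ n = 2 ^ n * (8 * Cb) ^ n := by
    rw [← mul_pow]; congr 1; ring
  have hc1 : (424 : ℝ) * 2 ^ (n + 34) * (8 * Cb) ^ n = 424 * 2 ^ 34 * (16 * Cb) ^ n := by
    rw [h16, pow_add]; ring
  have h8 : (1 : ℝ) ≤ (8 * Cb) ^ n := one_le_pow₀ (by linarith)
  have hc2 : (424 : ℝ) * 2 ^ (2 * n + 26) ≤ 424 * 2 ^ 26 * (16 * Cb) ^ n := by
    have e : (2 : ℝ) ^ (2 * n + 26) = 2 ^ 26 * 4 ^ n := by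
      rw [pow_add, pow_mul]; norm_num; ring
    have h4 : (4 : ℝ) ^ n ≤ (16 * Cb) ^ n := pow_le_pow_left₀ (by norm_num) (by linarith) n
    rw [e]; nlinarith
  have hsum : (424 : ℝ) * 2 ^ 34 * (16 * Cb) ^ n + 424 * 2 ^ 26 * (16 * Cb) ^ n ≤ 2 ^ 44 * (16 * Cb) ^ n := by
    have h16 : (0 : ℝ) ≤ (16 * Cb) ^ n := by positivity
    nlinarith
  have e1 : 424 * 2 ^ (n + 34) * (8 * Cb) ^ n * ((P.p : ℝ) / Real.log P.p) * P.Ω * P.Wplus =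
      (424 * 2 ^ (n + 34) * (8 * Cb) ^ n) * (P.p / Real.log P.p * P.Ω * P.Wplus) := by ring
  have e2 : 424 * 2 ^ (2 * n + 26) * ((P.p : ℝ) / Real.log P.p) * P.Ω * P.Wplus =
      (424 * 2 ^ (2 * n + 26)) * (P.p / Real.log P.p * P.Ω * P.Wplus) := by ring
  have e3 : (2 : ℝ) ^ 44 * (16 * Cb) ^ n * (P.p / Real.log P.p) * P.Ω * P.Wplus =
      (2 ^ 44 * (16 * Cb) ^ n) * (P.p / Real.log P.p * P.Ω * P.Wplus) := by ring
  rw [e1, hc1] at h1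
  rw [e2] at h2
  rw [e3]
  have h2' := le_trans h2 (mul_le_mul_of_nonneg_right hc2 hB0)
  have := mul_le_mul_of_nonneg_right hsum hB0
  linarith

end PadicG3Par

end Summit.ABC.StewartYu
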